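import Summits.SmoothPoincare4.SmoothPoincare4.Theorems.CongruenceShadowsAgkCor6SufficiencyGeomMarkingDefs
import Literature.Topology.FourManifolds.TrisectionFunctorGKCentralSurface

/-!
# Line `lp-by-sphere-system-surgery` — skeleton for crux `AgkCor6Sufficiency` (stmt-SmoothPoincare4-10894)
# Lead reshape r6b (continuation lead c2, 2026-08-16): Nielsen-free last step, marking at `g = 3k`,
# the marking stub opened up into generic cell lemmas + ONE model computation

Crux (route `CongruenceShadows`, shared with `GroupTrisection`):
`AgkCor6Sufficiency := X → SmoothPoincare4`, `X` = AGK's Cor. 6 condition.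

Everything of r5b is LANDED and imported (the twelve spine-transport stubs, the glue, the r5
assembly `CongruenceShadowsAgkCor6Sufficiency.lean`: `rigidity_of_facts hLP hGr hDS : (b′)`), as are
the r6 Nielsen-free last step (`…NielsenFree.lean`: `JCD`, `JCDStepStmt`,
`sphere_gkTrisections_of_jcdStep`, `stabilizableMarking_of_geomMarking_of_jcdStep`) and the r6b
glue (`…GeomMarkingDefs.lean`: cell vocabulary `IsChartCell` / `CellBasis`, `PuncturedFlowerModel`,
`GeomMarkingStmt3k`, `spc4_of_forall_isStablyTrivial_of_stabilizableMarking3k`,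
`agkCor6Sufficiency_of_facts_nielsenFree3k`).  So this skeleton only declares what is NOT proved:

* the three delegated named facts `stub_laudenbachPoenaru` (LP = Cerf `Γ₄ = 0` ∧ Thm A⁺, tree-tight),
  `stub_griffiths` (= crux item stmt-SmoothPoincare4-15190), `stub_dnbSurface` (fact seat live);
* `stub_jcdStep : JCDStepStmt` (one implant ON THE NOSE, general `X`; crux-sized: it is the `π₁`
  stage of the tree's implant, cf. `TrisectionFunctorGKStabilizationPi1.lean` docstring);
* the marking statement `GeomMarkingStmt3k` OPENED UP (r6b) into seven generic lemmas about
  chart-like cells in a closed subset of a Hausdorff space / central surfaces —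
  `stub_smallJointChartCell` (joint-chart cell inside a prescribed open set: restrict the chart),
  `stub_centralSurfaceFlower` (`F ≃ₜ` flower surface for `g ≥ 2`: clause (iii) handlebody ≅ flower
  handlebody by the proved uniqueness, boundary homeomorphisms), `stub_cellBasisGenusZero`
  (`g = 0`: `F ≅ S²`, `F` minus a point simply connected, tree's `exists_datum_genus_zero_of_cell`
  ingredients), `stub_cellBasisTransport` (cell bases move along homeomorphisms),
  `stub_nestedCellsRegion` + `stub_nestedCellsBasis` (the 2D ANNULUS THEOREM of
  `Topology/PlaneTopology/AnnulusTheorem.lean`: between a round cell circle and a smaller cell's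
  circle lies an annulus, so the cell basis of the big cell is one of the small cell),
  `stub_jcdOfCellBasis` (a cell basis at a joint-chart cell gives `JCD`: the marking `μ` by the
  tree's `exists_geometric_marking_of_closed_cover_collars`) — and ONE model computation,
  `stub_puncturedFlowerModel` (the flower surface minus a disc has free `π₁` of rank `2g` reading the
  boundary: melon slices, `exists_basis_union_of_arc`, `exists_freeBasis_union_of_closed_cover_collars`);
  assembled here (sorry-free) as `geomMarking3k_of_pieces`.

Registered stubs (12): `stub_laudenbachPoenaru`, `stub_griffiths`, `stub_dnbSurface`, `stub_jcdStep`,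
`stub_smallJointChartCell`, `stub_centralSurfaceFlower`, `stub_cellBasisGenusZero`,
`stub_cellBasisTransport`, `stub_nestedCellsRegion`, `stub_nestedCellsBasis`, `stub_jcdOfCellBasis`,
`stub_puncturedFlowerModel`; sorry-free composition `AgkCor6Sufficiency_of_stubStatements` and the
by-name skeleton theorems `AgkCor6Sufficiency_of` / `AgkCor6Sufficiency_of'`.

Disproof.lean (cdisprove cycles 1–4) honoured as in r6: `X` is used once, through
`spc4_of_forall_isStablyTrivial_of_stabilizableMarking3k` (the disprover's recommended X-once,
Nielsen-free architecture, `Negative/NoseLine.lean`); no stub mentions `X`; the refuted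
strengthenings (unbalanced / any group / on the nose) are untouched.
-/

set_option linter.dupNamespace false

noncomputable section

open Set Function ContinuousMap Metric
open scoped Manifold ContDiff Topology

namespace Summit.SmoothPoincare4.SmoothPoincare4.Cruxes.AgkCor6Sufficiency.LpBySphereSystemSurgery

open Literature.Topology.FourManifolds
open Literature.AlgebraicTopology.FundamentalGroup
open Literature.AlgebraicTopology.FundamentalGroup.VanKampen
open Literature.AlgebraicTopology.Homotopy
open Summit.SmoothPoincare4.SmoothPoincare4.Theses.CongruenceShadows (AgkCor6Sufficiency)

/-! ## 1. Registered stubs: the three delegated facts and the JCD step -/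

/-- **stub — Laudenbach–Poénaru** (tree named fact `exists_diffeomorph_comp_incl_eq`; tree-tight
`= Cerf Γ₄ = 0 ∧ laudenbachPoenaru_thmA_model_succ`; DELEGATED). -/
theorem stub_laudenbachPoenaru : exists_diffeomorph_comp_incl_eq.{0} := by
  sorry

/-- **stub — Griffiths' theorem** (tree named fact `GriffithsExtension`; = crux item
stmt-SmoothPoincare4-15190; DELEGATED). -/
theorem stub_griffiths : GriffithsExtension := by
  sorry

/-- **stub — smooth based Dehn–Nielsen–Baer on `∂H_g`** (tree named fact
`DehnNielsenBaerSurfaceSmooth`; fact seat live; DELEGATED). -/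
theorem stub_dnbSurface : DehnNielsenBaerSurfaceSmooth := by
  sorry

/-- **stub — the JCD step** (one unbalanced Gay–Kirby stabilisation ON THE NOSE with the
joint-chart datum handed on, general `X`; geometric half = the tree's proved
`IsGKTrisection.exists_stabilization_chart`, `π₁` stage = the tree's proved
`exists_marking_groupGKTrisectionOf_eq_stabilizeOne_datum`; what is missing is the identification of
the implant's pieces `A, P, C, A^H, B^H, E` with their `π₁` data). -/
theorem stub_jcdStep : JCDStepStmt := by
  sorry

/-! ## 2. Registered stubs: the pieces of the marking statement `GeomMarkingStmt3k` -/

/-- **stub — a joint-chart cell inside a prescribed open set.**  `IsGKTrisection.exists_jointChart_cell`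
with the chart first restricted to the open set `U ∋ x` (restrictions of charts of the maximal atlas
stay in it), so that `Θ.source ⊆ U`. -/
theorem stub_smallJointChartCell {X : Type} [TopologicalSpace X] [T2Space X]
    [ChartedSpace (EuclideanSpace ℝ (Fin 4)) X] [IsManifold (𝓡 4) ∞ X]
    {g : ℕ} {k : Fin 3 → ℕ} {S : Fin 3 → Set X} (h : IsGKTrisection X g k S) {i j : Fin 3}
    (hji : j ≠ i) {x : X} (hx : x ∈ ⋂ l, S l) {U : Set X} (hU : IsOpen U) (hxU : x ∈ U) :
    ∃ (Θ : OpenPartialHomeomorph X (EuclideanSpace ℝ (Fin 4))) (l : Fin 3) (ρ : ℝ)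
      (Φ : C(closedBall (0 : EuclideanSpace ℝ (Fin 2)) 2, X)) (O : Set X),
      Θ ∈ IsManifold.maximalAtlas (𝓡 4) ∞ X ∧ x ∈ Θ.source ∧ Θ x = 0 ∧ l ≠ i ∧ l ≠ j ∧
      (∀ y ∈ Θ.source, y ∈ S i ↔ (0 ≤ Θ y 0 ∧ 0 ≤ Θ y 1)) ∧
      (∀ y ∈ Θ.source, y ∈ (⋂ m, S m) ↔ (Θ y 0 = 0 ∧ Θ y 1 = 0)) ∧
      (∀ y ∈ Θ.source, y ∈ S j ↔ (Θ y 0 ≤ 0 ∧ Θ y 0 ≤ Θ y 1)) ∧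
      (∀ y ∈ Θ.source, y ∈ S l ↔ (Θ y 1 ≤ 0 ∧ Θ y 1 ≤ Θ y 0)) ∧
      0 < ρ ∧ (∀ z, Φ z ∈ Θ.source) ∧
      (∀ z, Θ (Φ z) =
        !₂[0, 0, ρ * (z : EuclideanSpace ℝ (Fin 2)) 0, ρ * (z : EuclideanSpace ℝ (Fin 2)) 1]) ∧
      Φ ⟨0, by simp⟩ = x ∧ Injective Φ ∧ range Φ ⊆ (⋂ m, S m) ∧ IsOpen O ∧ O ⊆ Θ.source ∧ x ∈ O ∧
      O = {y | y ∈ Θ.source ∧ ‖(!₂[Θ y 2, Θ y 3] : EuclideanSpace ℝ (Fin 2))‖ < 2 * ρ} ∧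
      (⋂ m, S m) ∩ O = Φ '' {z | ‖(z : EuclideanSpace ℝ (Fin 2))‖ < 2} ∧
      Θ.source ⊆ U := by
  sorry

/-- **stub — the central surface of a balanced genus-`g ≥ 2` trisection is homeomorphic to the
flower surface.**  Clause (iii) gives a genus-`g` handlebody `H` smoothly embedded with
`h(∂H) = F` (`IsGKTrisection.exists_isHandlebody`); `H ≅ FlowerHandlebody` by the proved uniqueness
(`IsHandlebody.nonempty_diffeomorph_of_oneHandle oneHandle_nonempty_diffeomorph_holds`);
boundary homeomorphisms `Diffeomorph.boundaryHomeomorph`, `FlowerModel.boundaryHomeomorph`,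
`flowerSurface_def` (as in `exists_marking_centralSurface_of_isHandlebody_of_model`). -/
theorem stub_centralSurfaceFlower {g : ℕ} (hg : 2 ≤ g)
    (X : Type) [TopologicalSpace X] [T2Space X] [SecondCountableTopology X]
    [ChartedSpace (EuclideanSpace ℝ (Fin 4)) X] [IsManifold (𝓡 4) ∞ X] [CompactSpace X]
    [ConnectedSpace X] (o : SmoothOrientation (𝓡 4) X) (k : ℕ) (S : Fin 3 → Set X)
    (h : IsBalancedGKTrisection X g k S) :
    Nonempty (centralSurface S ≃ₜ ↥(FlowerModel.flowerSurface g)) := by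
  sorry

/-- **stub — genus `0`: every chart-like cell in the central `2`-sphere carries the (trivial) cell
basis.**  `F ≅ ∂𝔻³ = S²` (`IsGKTrisection.isSimplyConnected_iInter_of_genus_zero`'s proof), `S²`
minus a point is simply connected (stereographic projection), so `F` minus the hole is simply
connected (`isSimplyConnected_diff_image_ball`) and the genus-`0` reading is trivial
(`exists_datum_genus_zero_of_cell`). -/
theorem stub_cellBasisGenusZero (X : Type) [TopologicalSpace X] [T2Space X] [SecondCountableTopology X]
    [ChartedSpace (EuclideanSpace ℝ (Fin 4)) X] [IsManifold (𝓡 4) ∞ X] [CompactSpace X]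
    [ConnectedSpace X] (o : SmoothOrientation (𝓡 4) X) (k : ℕ) (S : Fin 3 → Set X)
    (h : IsBalancedGKTrisection X 0 k S)
    (Φ : C(closedBall (0 : EuclideanSpace ℝ (Fin 2)) 2, X)) (O : Set X)
    (hc : IsChartCell (⋂ m, S m) Φ O) : CellBasis (⋂ m, S m) Φ 0 := by
  sorry

/-- **stub — cell bases move along homeomorphisms.**  A chart-like cell `Ψ` of the whole space `Z`
with a genus-`g` cell basis, pulled back along a homeomorphism `e : F ≃ₜ Z` of a closed subset
`F ⊆ X` (subspace topology), is a chart-like cell in `F` with a genus-`g` cell basis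
(functoriality of `π₁` under homeomorphisms of pairs; the open set `O'` from the subspace topology). -/
theorem stub_cellBasisTransport {X : Type} [TopologicalSpace X] [T2Space X] {F : Set X}
    (hF : IsClosed F) {Z : Type} [TopologicalSpace Z] [T2Space Z] (e : ↥F ≃ₜ Z)
    (Ψ : C(closedBall (0 : EuclideanSpace ℝ (Fin 2)) 2, Z)) (OZ : Set Z)
    (hc : IsChartCell (univ : Set Z) Ψ OZ) {g : ℕ} (hb : CellBasis (univ : Set Z) Ψ g) :
    ∃ (Ψ' : C(closedBall (0 : EuclideanSpace ℝ (Fin 2)) 2, X)) (O' : Set X),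
      (∀ z, Ψ' z = (e.symm (Ψ z) : X)) ∧ IsChartCell F Ψ' O' ∧ CellBasis F Ψ' g := by
  sorry

/-- **stub — the region between nested cells** (2D annulus theorem,
`Literature/Topology/PlaneTopology/AnnulusTheorem.lean`, `exists_homeomorph_image_annulus`): for
chart-like cells `Φ, Ψ` in the closed `F` with `Φ(B̄(0,1)) ⊆ Ψ(B(0,1))`, read in the coordinates
of `Ψ`, the curve `Ψ⁻¹Φ(‖z‖ = 1)` is a Jordan curve in the unit disc whose interior is
`Ψ⁻¹Φ(B(0,1))` (invariance of domain), so `R = Ψ(B̄(0,1)) ∖ Φ(B(0,1))` is a closed annulus: it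
strong-deformation-retracts onto the outer circle `Ψ(‖z‖ = 1)`, is path connected, and any
generator of `π₁` of the inner circle `Φ(‖z‖ = 1)` generates `π₁(R)`. -/
theorem stub_nestedCellsRegion {X : Type} [TopologicalSpace X] [T2Space X] {F : Set X}
    (hF : IsClosed F) (Φ Ψ : C(closedBall (0 : EuclideanSpace ℝ (Fin 2)) 2, X)) (OΦ OΨ : Set X)
    (hΦ : IsChartCell F Φ OΦ) (hΨ : IsChartCell F Ψ OΨ) (hnest : cellDisc Φ ⊆ cellHole Ψ) :
    IsStrongDeformationRetractOf (cellCircle Ψ) (cellDisc Ψ \ cellHole Φ) ∧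
    IsPathConnected (cellDisc Ψ \ cellHole Φ) ∧
    ∃ (hx : Φ cellPt ∈ cellCircle Φ) (hCR : cellCircle Φ ⊆ cellDisc Ψ \ cellHole Φ),
      ∀ t : FundamentalGroup ↥(cellCircle Φ) ⟨Φ cellPt, hx⟩, Subgroup.closure {t} = ⊤ →
        Subgroup.closure {inclHomOfSubset hCR _ hx (hCR hx) t} = ⊤ := by
  sorry

/-- **stub — the cell basis descends from a cell to a nested smaller cell.**  With `A = F ∖ Ψ(B(0,1))`
and the annular region `R = Ψ(B̄(0,1)) ∖ Φ(B(0,1))` (strong deformation retracting onto the seam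
circle `Ψ(‖z‖ = 1) = A ∩ R`, path connected, `π₁(R)` generated by the inner circle — the outputs
of `stub_nestedCellsRegion`, taken as hypotheses): `F ∖ Φ(B(0,1)) = A ∪ R` strong-deformation-retracts
onto `A` (pasting, `IsStrongDeformationRetractOf.union_of_inter_subset`), so
`π₁(A) → π₁(F ∖ Φ(B(0,1)))` is bijective (`bijective_inclHomOfSubset_of_isStrongDeformationRetractOf`);
move the base point to `Φ(1,0)` along a path in `R`; in `π₁(R) ≅ ℤ` the transported outer
generator is the inner generator or its inverse, which is the new `t`. -/
theorem stub_nestedCellsBasis {X : Type} [TopologicalSpace X] [T2Space X] {F : Set X}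
    (hF : IsClosed F) (Φ Ψ : C(closedBall (0 : EuclideanSpace ℝ (Fin 2)) 2, X)) (OΦ OΨ : Set X)
    (hΦ : IsChartCell F Φ OΦ) (hΨ : IsChartCell F Ψ OΨ) (hnest : cellDisc Φ ⊆ cellHole Ψ)
    (hsdr : IsStrongDeformationRetractOf (cellCircle Ψ) (cellDisc Ψ \ cellHole Φ))
    (hRpc : IsPathConnected (cellDisc Ψ \ cellHole Φ))
    (hx : Φ cellPt ∈ cellCircle Φ) (hCR : cellCircle Φ ⊆ cellDisc Ψ \ cellHole Φ)
    (hgen : ∀ t : FundamentalGroup ↥(cellCircle Φ) ⟨Φ cellPt, hx⟩, Subgroup.closure {t} = ⊤ →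
        Subgroup.closure {inclHomOfSubset hCR _ hx (hCR hx) t} = ⊤)
    {g : ℕ} (hb : CellBasis F Ψ g) : CellBasis F Φ g := by
  sorry

/-- **stub — a cell basis at a joint-chart cell gives the joint-chart datum `JCD`.**  The marking
`μ : S_g ≃* π₁(F, Φ(1,0))` with `μ ∘ mk = (A ⊆ F)_* ∘ θ` comes from the tree's
`exists_geometric_marking_of_closed_cover_collars` for the closed cover `F = A ∪ D`,
`A = F ∖ Φ(B(0,1))`, `D = Φ(B̄(0,1))` (a disc, `π₁ = 1`), seam `C = Φ(‖z‖ = 1)` with the collars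
`Φ(1 ≤ ‖z‖ < 2) = A ∩ O` (`diff_image_ball_inter_eq`, `isStrongDeformationRetractOf_image_sphere_collar`)
and `Φ(1/2 < ‖z‖ ≤ 1)` (radial); everything else is repackaging of `IsChartCell` / `CellBasis`
(`cellPt`, `cellHole`, `cellCircle` unfold to the sets of `JCD`). -/
theorem stub_jcdOfCellBasis {X : Type} [TopologicalSpace X] [T2Space X]
    [ChartedSpace (EuclideanSpace ℝ (Fin 4)) X] {g : ℕ} {k : Fin 3 → ℕ} {S : Fin 3 → Set X}
    (h : IsGKTrisection X g k S)
    (Θ : OpenPartialHomeomorph X (EuclideanSpace ℝ (Fin 4))) (i j l : Fin 3) (ρ : ℝ)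
    (Φ : C(closedBall (0 : EuclideanSpace ℝ (Fin 2)) 2, X)) (O : Set X)
    (hΘ : Θ ∈ IsManifold.maximalAtlas (𝓡 4) ∞ X) (hji : j ≠ i) (hli : l ≠ i) (hlj : l ≠ j)
    (hSi : ∀ y ∈ Θ.source, y ∈ S i ↔ (0 ≤ Θ y 0 ∧ 0 ≤ Θ y 1))
    (hF : ∀ y ∈ Θ.source, y ∈ (⋂ m, S m) ↔ (Θ y 0 = 0 ∧ Θ y 1 = 0))
    (hSj : ∀ y ∈ Θ.source, y ∈ S j ↔ (Θ y 0 ≤ 0 ∧ Θ y 0 ≤ Θ y 1))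
    (hSl : ∀ y ∈ Θ.source, y ∈ S l ↔ (Θ y 1 ≤ 0 ∧ Θ y 1 ≤ Θ y 0))
    (hρ : 0 < ρ) (hsrc : ∀ z, Φ z ∈ Θ.source)
    (hΘΦ : ∀ z, Θ (Φ z) =
      !₂[0, 0, ρ * (z : EuclideanSpace ℝ (Fin 2)) 0, ρ * (z : EuclideanSpace ℝ (Fin 2)) 1])
    (hinj : Injective Φ) (hΦF : range Φ ⊆ ⋂ m, S m) (hO : IsOpen O) (hOsrc : O ⊆ Θ.source)
    (hOeq : O = {y | y ∈ Θ.source ∧ ‖(!₂[Θ y 2, Θ y 3] : EuclideanSpace ℝ (Fin 2))‖ < 2 * ρ})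
    (hFO : (⋂ m, S m) ∩ O = Φ '' {z | ‖(z : EuclideanSpace ℝ (Fin 2))‖ < 2})
    (hB : CellBasis (⋂ m, S m) Φ g) :
    ∃ μ : SurfaceGroup g ≃* FundamentalGroup (centralSurface S) ⟨Φ cellPt, hΦF ⟨cellPt, rfl⟩⟩,
      JCD X g S ⟨Φ cellPt, hΦF ⟨cellPt, rfl⟩⟩ μ := by
  sorry

/-- **stub — the punctured flower model** (the ONE model computation of the marking statement):
for `g ≥ 2` the flower surface carries a chart-like cell with a genus-`g` cell basis. -/
theorem stub_puncturedFlowerModel (g : ℕ) (hg : 2 ≤ g) : PuncturedFlowerModel g := by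
  sorry

/-! ## 3. Assembly of the marking statement (proved from the pieces) -/

section Assembly

variable {X : Type} [TopologicalSpace X]

/-- The hole of a chart-like cell is the trace on `F` of an open set of the ambient space
(remove the compact annulus `Φ(1 ≤ ‖z‖ ≤ 2)` from `O`). -/
theorem exists_isOpen_inter_eq_cellHole [T2Space X] {F : Set X}
    (Φ : C(closedBall (0 : EuclideanSpace ℝ (Fin 2)) 2, X)) (O : Set X) (hc : IsChartCell F Φ O) :
    ∃ U : Set X, IsOpen U ∧ F ∩ U = cellHole Φ := by
  obtain ⟨hinj, -, hO, hFO⟩ := hc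
  set K : Set X := Φ '' {z | 1 ≤ ‖(z : EuclideanSpace ℝ (Fin 2))‖} with hK
  have hKc : IsCompact K := by
    haveI : CompactSpace (closedBall (0 : EuclideanSpace ℝ (Fin 2)) 2) :=
      isCompact_iff_compactSpace.mp (isCompact_closedBall _ _)
    refine IsCompact.image (IsClosed.isCompact ?_) Φ.continuous
    exact isClosed_le continuous_const (continuous_norm.comp continuous_subtype_val)
  refine ⟨O \ K, hO.sdiff hKc.isClosed, ?_⟩
  rw [← inter_sdiff_assoc, hFO]
  ext y
  simp only [mem_diff, mem_image, mem_setOf_eq, cellHole, hK]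
  constructor
  · rintro ⟨⟨z, hz, rfl⟩, hy⟩
    refine ⟨z, ?_, rfl⟩
    by_contra hlt
    exact hy ⟨z, not_lt.mp hlt, rfl⟩
  · rintro ⟨z, hz, rfl⟩
    refine ⟨⟨z, by linarith, rfl⟩, ?_⟩
    rintro ⟨w, hw, hwz⟩
    have : w = z := hinj hwz
    subst this
    exact absurd hz (not_lt.mpr hw)

/-- **The marking statement at `g = 3k` from the pieces** (sorry-free assembly; `sorry` only in the
`stub_*` it invokes): genus `0` from `stub_cellBasisGenusZero`; genus `3k ≥ 3` by transporting the
punctured flower model to the central surface (`stub_centralSurfaceFlower`,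
`stub_cellBasisTransport`), placing a small joint-chart cell inside the transported hole
(`stub_smallJointChartCell`), descending the cell basis through the annulus
(`stub_nestedCellsRegion`, `stub_nestedCellsBasis`), and packaging (`stub_jcdOfCellBasis`). -/
theorem geomMarking3k_of_pieces : GeomMarkingStmt3k := by
  intro X _ _ _ _ _ _ _ o k S h
  have hGK : IsGKTrisection X (3 * k) (fun _ => k) S := h
  have hFc : IsClosed (⋂ m, S m) := hGK.isCompact_iInter.isClosed
  rcases Nat.eq_zero_or_pos k with rfl | hk
  · -- genus `0`
    obtain ⟨x⟩ := hGK.nonempty_centralSurface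
    obtain ⟨Θ, l, ρ, Φ, O, hΘ, -, -, hl0, hl1, hSi, hF, hSj, hSl, hρ, hsrc, hΘΦ, -, hinj, hΦF, hO,
      hOsrc, -, hOeq, hFO⟩ := hGK.exists_jointChart_cell (i := 0) (j := 1) (by decide) x.2
    have hc : IsChartCell (⋂ m, S m) Φ O := ⟨hinj, hΦF, hO, hFO⟩
    have h0 : IsBalancedGKTrisection X 0 0 S := by simpa using h
    have hB : CellBasis (⋂ m, S m) Φ (3 * 0) := by
      simpa using stub_cellBasisGenusZero X o 0 S h0 Φ O hc
    obtain ⟨μ, hJ⟩ := stub_jcdOfCellBasis hGK Θ 0 1 l ρ Φ O hΘ (by decide) hl0 hl1 hSi hF hSj hSl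
      hρ hsrc hΘΦ hinj hΦF hO hOsrc hOeq hFO hB
    exact ⟨_, μ, hJ⟩
  · -- genus `3k ≥ 3`: the flower model
    have hg : 2 ≤ 3 * k := by omega
    obtain ⟨e⟩ := stub_centralSurfaceFlower hg X o k S h
    obtain ⟨Ψ, OZ, hcZ, hbZ⟩ := stub_puncturedFlowerModel (3 * k) hg
    obtain ⟨Ψ', O', -, hc', hb'⟩ := stub_cellBasisTransport hFc e Ψ OZ hcZ hbZ
    -- a small joint-chart cell centred at the centre of `Ψ'`
    obtain ⟨U, hU, hFU⟩ := exists_isOpen_inter_eq_cellHole Ψ' O' hc'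
    have hxhole : Ψ' ⟨0, by simp⟩ ∈ cellHole Ψ' := ⟨⟨0, by simp⟩, by simp, rfl⟩
    have hxFU : Ψ' ⟨0, by simp⟩ ∈ (⋂ m, S m) ∩ U := by rw [hFU]; exact hxhole
    obtain ⟨Θ, l, ρ, Φ, O, hΘ, -, -, hl0, hl1, hSi, hF, hSj, hSl, hρ, hsrc, hΘΦ, -, hinj, hΦF, hO,
      hOsrc, -, hOeq, hFO, hsU⟩ :=
      stub_smallJointChartCell hGK (i := 0) (j := 1) (by decide) hxFU.1 hU hxFU.2
    have hcΦ : IsChartCell (⋂ m, S m) Φ O := ⟨hinj, hΦF, hO, hFO⟩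
    have hnest : cellDisc Φ ⊆ cellHole Ψ' := by
      rintro _ ⟨z, -, rfl⟩
      have : Φ z ∈ (⋂ m, S m) ∩ U := ⟨hΦF ⟨z, rfl⟩, hsU (hsrc z)⟩
      rwa [hFU] at this
    obtain ⟨hsdr, hRpc, hx, hCR, hgen⟩ := stub_nestedCellsRegion hFc Φ Ψ' O O' hcΦ hc' hnest
    have hB : CellBasis (⋂ m, S m) Φ (3 * k) :=
      stub_nestedCellsBasis hFc Φ Ψ' O O' hcΦ hc' hnest hsdr hRpc hx hCR hgen hb'
    obtain ⟨μ, hJ⟩ := stub_jcdOfCellBasis hGK Θ 0 1 l ρ Φ O hΘ (by decide) hl0 hl1 hSi hF hSj hSl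
      hρ hsrc hΘΦ hinj hΦF hO hOsrc hOeq hFO hB
    exact ⟨_, μ, hJ⟩

end Assembly

/-! ## 4. The composition (lead reshape r6b) -/

/-- **The skeleton theorem: the crux BY NAME from the twelve registered stubs** — (b′) from the
landed line (`rigidity_of_facts`) and the three delegated facts; (d′) + (G) at `g = 3k` from the
JCD step and the marking pieces; `sorry` occurs only inside the `stub_*` declarations invoked. -/
theorem AgkCor6Sufficiency_of : AgkCor6Sufficiency :=
  agkCor6Sufficiency_of_facts_nielsenFree3k stub_laudenbachPoenaru stub_griffiths stub_dnbSurface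
    geomMarking3k_of_pieces stub_jcdStep

/-- **The same for the shared decl of route `GroupTrisection`** (identical body; the decl
`ledger skeleton check` resolves by default). -/
theorem AgkCor6Sufficiency_of' :
    Summit.SmoothPoincare4.SmoothPoincare4.Theses.GroupTrisection.AgkCor6Sufficiency :=
  agkCor6Sufficiency'_of_facts_nielsenFree3k stub_laudenbachPoenaru stub_griffiths stub_dnbSurface
    geomMarking3k_of_pieces stub_jcdStep

end Summit.SmoothPoincare4.SmoothPoincare4.Cruxes.AgkCor6Sufficiency.LpBySphereSystemSurgery

end
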